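import Literature.Probability.RandomPlanarGeometry.HullApproximationProofs
import Literature.Probability.RandomPlanarGeometry.RestrictionContinuity
import HarnessLib

/-!
# The smooth hulls of [LSW] Lemma 2.1 converge in the sense of Lemma 3.5 (`E_δ → A`)

G. F. Lawler, O. Schramm, W. Werner, *Conformal restriction: the chordal case*, J. Amer. Math.
Soc. **16** (2003) 917–955, arXiv:math/0209343 (**[LSW]**, arXiv page numbers), proof of
Lemma 3.5, p. 13: "It is clear that `E_δ → A` as `δ → 0+` in the topology considered above. It
thus suffices to approximate `E_δ`."

Proof-only file. The tree proves [LSW] Lemma 2.1 with the Lemma 3.5 convergence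
(`IsPlusHull.exists_antitone_isArcHull_holds`, `HullApproximationProofs`: a decreasing sequence
of smooth `+`-hulls `J_n ⊇ A` with `⋂ J_n = A ∪ [x₀, x₁]` whose restriction maps converge to
`Φ_A` uniformly on every `S ⊆ ℍ` with compact closure missing `A ∪ [x₀, x₁]`). Here we record
that this IS convergence `J_n → A` in the sense of the proof of Lemma 3.5 as vendored in
`RestrictionDensity` (`LSWConverges`: the `J_n` are bounded away from `0` and `∞`, compacts of
`ℍ ∖ A` are eventually disjoint from `J_n` and carry uniform convergence, and the convergence is
uniform on a half-disc about `0`):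

* `IsPlusHull.exists_isArcHull_lswConverges` — every nonempty `A ∈ 𝒬₊` is the `LSWConverges`
  limit of a decreasing sequence of smooth `+`-hulls `J_n ⊇ A`.

This is the first half ("`E_δ → A`") of the density clause of Lemma 3.5 (the named fact
`IsPlusHull.exists_isLSWGenerated_lswConverges` of `RestrictionDensity`), reducing it — up to a
diagonal argument — to the approximation of SMOOTH hulls by the semigroup `𝒜₀`, which is the
Loewner-equation part of the printed proof.
-/

noncomputable section

open Set Filter Metric Bornology Complex
open _root_.Topology
open UpperHalfPlane (upperHalfPlaneSet isOpen_upperHalfPlaneSet)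

namespace Literature.Probability.RandomPlanarGeometry

/-- **`E_δ → A` ([LSW] p. 13) in the sense of `LSWConverges`**: for a nonempty `A ∈ 𝒬₊` with
restriction map `Φ_A` there is a decreasing sequence of smooth `+`-hulls `J_n ⊇ A` (those of
Lemma 2.1, `IsPlusHull.exists_antitone_isArcHull_holds`) with restriction maps `Ψ_n` such that
`J_n → A` in the sense of the proof of Lemma 3.5. [cite: LawlerSchrammWerner2003Restriction, proof of Lemma 3.5 (p. 13), "E_δ → A"] -/
theorem IsPlusHull.exists_isArcHull_lswConverges {A : Set ℂ} (hA : IsPlusHull A) (hne : A.Nonempty)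
    {Φ : ConformalEquiv (upperHalfPlaneSet \ A) upperHalfPlaneSet} (hΦ : IsRestrictionMap A Φ) :
    ∃ (J : ℕ → Set ℂ) (Ψ : ∀ n, ConformalEquiv (upperHalfPlaneSet \ J n) upperHalfPlaneSet),
      (∀ n, IsArcHull (J n)) ∧ (∀ n, IsPlusHull (J n)) ∧ Antitone J ∧ (∀ n, A ⊆ J n) ∧
        (∀ n, IsRestrictionMap (J n) (Ψ n)) ∧ LSWConverges A Φ J Ψ := by
  obtain ⟨J, hJa, hJp, hJm, hJi, hconv⟩ := IsPlusHull.exists_antitone_isArcHull_holds hA hne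
  choose Ψ hΨ _ using fun n ↦ IsStarHull.existsUnique_isRestrictionMap_holds (hJp n).1
  have hfill : realFill A ⊆ J 0 := fun z hz ↦ by
    rw [← hJi] at hz; exact mem_iInter.1 hz 0
  have hAJ : ∀ n, A ⊆ J n := fun n z hz ↦ by
    have : z ∈ ⋂ n, J n := by rw [hJi]; exact subset_realFill A hz
    exact mem_iInter.1 this n
  obtain ⟨hunif, -⟩ := hconv hΦ hΨ
  -- a common annulus: `J n ⊆ J 0 ⊆ {δ ≤ |z| ≤ 1/δ}`
  obtain ⟨δ, hδ, hJ0⟩ := (hJp 0).1.exists_subset_norm_annulus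
  refine ⟨J, Ψ, hJa, hJp, hJm, hAJ, hΨ, ⟨δ, hδ, fun n ↦ (hJm (Nat.zero_le n)).trans hJ0⟩, ?_, ?_⟩
  · -- compacts of `ℍ ∖ A`
    intro S hS hSA
    have hSH : S ⊆ upperHalfPlaneSet := fun z hz ↦ (hSA hz).1
    have hSd : Disjoint (closure S) (realFill A) := by
      rw [hS.isClosed.closure_eq]
      exact Set.disjoint_left.2 fun z hz hzF ↦
        (hSA hz).2 (realFill_inter_upperHalfPlaneSet_subset A ⟨hzF, hSH hz⟩)
    refine ⟨?_, hunif S hSH (by rwa [hS.isClosed.closure_eq]) hSd⟩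
    have hSc : IsCompact (closure S) := by rwa [hS.isClosed.closure_eq]
    have := eventually_disjoint_of_iInter_eq (fun n ↦ (hJp n).1.isBoundedHull.isClosed) hJm hJi
      hSc hSd
    simpa [hS.isClosed.closure_eq] using this
  · -- near `0`: `ℍ ∩ B(0, δ/2)` has compact closure missing `A' ⊆ J 0 ⊆ {δ ≤ |z|}`
    refine ⟨δ / 2, by positivity, hunif _ inter_subset_left
      ((isCompact_closedBall (0 : ℂ) (δ / 2)).of_isClosed_subset isClosed_closure
        (closure_minimal (inter_subset_right.trans ball_subset_closedBall) isClosed_closedBall)) ?_⟩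
    refine Set.disjoint_left.2 fun z hz hzF ↦ ?_
    have h1 : ‖z‖ ≤ δ / 2 := mem_closedBall_zero_iff.1
      (closure_minimal (inter_subset_right.trans ball_subset_closedBall) isClosed_closedBall hz)
    have h2 : δ ≤ ‖z‖ := (hJ0 (hfill hzF)).1
    linarith

end Literature.Probability.RandomPlanarGeometry

end
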